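import Literature.NumberTheory.EllipticCurves.DivisionFieldReducibleBorelRootOfUnity
import HarnessLib

/-!
# `det ρ̄ = ω` on the Borel field of a line: `τ ζ = ζ^{a₁ a₂}` for `ζ = e_p(P, P₂)`, `τP = a₁P`, `τP₂ ≡ a₂P₂ (mod C)`
# (theorems only; no definition, no named fact)

Topic `NumberTheory/EllipticCurves` (namespace `WeierstrassCurve`, as the siblings `DivisionFieldReducibleBorel*.lean`).  Written by the
prover seat `bsd-potss-rkm` g41 (cell `bsd-potss`, item stmt-BirchSwinnertonDyer-19196 `ReducibleKatoMember`, crux M of K9 / K8-t′;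
`--supports`, closes nothing).

WHY.  `DivisionFieldReducibleBorelRootOfUnity.lean` shows `μ_p ⊆ L = K(χ₁, χ₂)` (the Borel field of a stable line `C` of a reducible
`E[p]`).  The isotypic reflection theorem (`NumberFields/LeopoldtReflectionIsotypic*.lean`) pairs the character `ψ = χ_even` with
`ψ* = ω ψ⁻¹`, and on a reducible row `ψ*` must be IDENTIFIED with `χ_odd`: this is the sentence «`χ₁ χ₂ = det ρ̄ = ω`» (Serre 1972 §4),
in the concrete form the Summit doors consume — the Galois action on the explicit root of unity `ζ = e_p(P, P₂)` (`P` a generator of `C`,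
`P₂ ∉ C`): for `τ ∈ Γ_K` with `τP = a₁P` and `τP₂ − a₂P₂ ∈ C`, **`τ ζ = ζ^{a₁ a₂}`** (bilinearity and `e_p(P, C) = 1`).

* `exists_isPrimitiveRoot_borelField_smul_eq_pow` — `∃ ζ ∈ K(χ₁,χ₂)` primitive `p`-th root of unity with `(τ|_L) ζ = ζ^{a₁a₂}` for all
  such `τ, a₁, a₂`.

References: [SilvermanAEC2009] Prop. III.8.1 (Weil pairing: bilinear, alternating, non-degenerate, Galois equivariant; tree
`exists_weilPairing_holds`, PROVED); [Serre1972] §4 (Borel image, `χ₁χ₂ = χ`).  Design: no `instance`, no notation.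
Axioms: `propext`, `Classical.choice`, `Quot.sound`.
-/

set_option autoImplicit false

noncomputable section

open scoped Classical
open Field IntermediateField Literature.NumberTheory.EllipticCurves Literature.NumberTheory.GaloisRepresentations

universe u

namespace WeierstrassCurve

variable {K : Type u} [Field K] [CharZero K] (W : WeierstrassCurve K) {p : ℕ}

omit [CharZero K] in
/-- `((τ|_E) x : K̄) = τ • x`. [folklore] -/
private theorem coe_absRestrictNormalHom_apply₄ (E : IntermediateField K (AlgebraicClosure K)) [Normal K E]
    (τ : absoluteGaloisGroup K) (x : E) :
    ((absRestrictNormalHom E τ x : E) : AlgebraicClosure K) = τ • (x : AlgebraicClosure K) :=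
  AlgEquiv.restrictNormalHom_apply E _ x

/-- **`det ρ̄ = ω` on the Borel field, concretely.**  Let `C` be a `Γ_K`-stable line of `E[p]` (`C ≠ 0, E[p]`; `E` elliptic,
`char K = 0`), `P ∈ C ∖ 0`, `P₂ ∉ C`.  Then there is a primitive `p`-th root of unity `ζ ∈ K(χ₁, χ₂)` (namely `e_p(P, P₂)`) such that
for every `τ ∈ Γ_K` acting by `τP = a₁P` and `τP₂ − a₂P₂ ∈ C` (`a₁, a₂ : ℕ`): `(τ|_{K(χ₁,χ₂)}) ζ = ζ^{a₁ a₂}` — i.e. `ω(τ) ≡ χ₁(τ) χ₂(τ)`.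
[cite: SilvermanAEC2009, Prop. III.8.1 (a)–(d)] [cite: Serre1972, §4 (Borel image: χ₁χ₂ = det = χ)] -/
theorem exists_isPrimitiveRoot_borelField_smul_eq_pow [W.IsElliptic] [hp : Fact p.Prime]
    (C : AddSubgroup (W.geomTorsion (p : ℤ)))
    (hC : ∀ (σ : absoluteGaloisGroup K) (x : W.geomTorsion (p : ℤ)), x ∈ C → σ • x ∈ C)
    (h1 : C ≠ ⊥) (h2 : C ≠ ⊤) (P : W.geomTorsion (p : ℤ)) (hPC : P ∈ C) (hP0 : P ≠ 0)
    (P₂ : W.geomTorsion (p : ℤ)) (hP₂ : P₂ ∉ C) :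
    haveI : NeZero p := ⟨hp.out.ne_zero⟩
    haveI := isGalois_borelField (W := W) hC
    ∃ ζ : ↥(W.borelField C), IsPrimitiveRoot ζ p ∧
      ∀ (τ : absoluteGaloisGroup K) (a₁ a₂ : ℕ), τ • P = a₁ • P → τ • P₂ - a₂ • P₂ ∈ C →
        absRestrictNormalHom (W.borelField C) τ ζ = ζ ^ (a₁ * a₂) := by
  have hpr : p.Prime := hp.out
  haveI : NeZero p := ⟨hpr.ne_zero⟩
  haveI := isGalois_borelField (W := W) hC
  -- cardinalities; `C = ℤ P`
  have hV : Nat.card (W.geomTorsion (p : ℤ)) = p ^ 2 := W.natCard_geomTorsion_eq_sq_of_charZero hpr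
  have hcard : Nat.card C = p := card_eq_of_ne_bot_of_ne_top hV h1 h2
  have hgen : ∀ c : W.geomTorsion (p : ℤ), c ∈ C → ∃ k : ℤ, c = k • P := by
    intro c hc
    haveI : Fact (Nat.card C).Prime := ⟨by rw [hcard]; exact hpr⟩
    have hP0' : (⟨P, hPC⟩ : C) ≠ 0 := fun h => hP0 (congrArg Subtype.val h)
    have htop := zmultiples_eq_top_of_prime_card hcard hP0'
    have hmem : (⟨c, hc⟩ : C) ∈ AddSubgroup.zmultiples (⟨P, hPC⟩ : C) := by rw [htop]; exact AddSubgroup.mem_top _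
    obtain ⟨k, hk⟩ := AddSubgroup.mem_zmultiples_iff.mp hmem
    refine ⟨k, ?_⟩
    have := congrArg (fun z : C => (z : W.geomTorsion (p : ℤ))) hk
    simpa using this.symm
  -- the Weil pairing
  obtain ⟨e, hpow, haddl, haddr, hself, hnd, hgal⟩ :=
    W.exists_weilPairing_holds p hpr.two_le (Nat.cast_ne_zero.mpr hpr.ne_zero)
  have hne0 : ∀ S T, e S T ≠ 0 := fun S T h0 => by
    have := hpow S T
    rw [h0, zero_pow hpr.ne_zero] at this
    exact zero_ne_one this
  have hskew : ∀ S T, e S T * e T S = 1 := fun S T => by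
    have h := hself (S + T)
    rw [haddl, haddr, haddr, hself S, hself T, one_mul, mul_one] at h
    exact h
  -- bilinearity in integer / natural multiples
  have hzero_r : ∀ S, e S 0 = 1 := fun S => by
    have h := haddr S 0 0
    rw [add_zero] at h
    exact (mul_right_eq_self₀.mp h.symm).resolve_right (hne0 S 0)
  have hzero_l : ∀ T, e 0 T = 1 := fun T => by
    have h := haddl 0 0 T
    rw [add_zero] at h
    exact (mul_right_eq_self₀.mp h.symm).resolve_right (hne0 0 T)
  have hzs : ∀ (S : W.geomTorsion (p : ℤ)) (m : ℤ), e S (m • P) = e S P ^ m := by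
    intro S m
    induction m using Int.induction_on with
    | zero => rw [zero_smul, hzero_r, zpow_zero]
    | succ n ih => rw [add_smul, one_smul, haddr, ih, zpow_add_one₀ (hne0 S P)]
    | pred n ih =>
      have h := haddr S ((-(n : ℤ) - 1) • P) P
      rw [show (-(n : ℤ) - 1) • P + P = (-(n : ℤ)) • P by rw [sub_smul, one_smul, sub_add_cancel], ih] at h
      rw [zpow_sub_one₀ (hne0 S P), eq_mul_inv_iff_mul_eq₀ (hne0 S P)]
      exact h.symm
  have hns_r : ∀ (S T : W.geomTorsion (p : ℤ)) (n : ℕ), e S (n • T) = e S T ^ n := by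
    intro S T n
    induction n with
    | zero => rw [zero_smul, hzero_r, pow_zero]
    | succ n ih => rw [add_smul, one_smul, haddr, ih, pow_succ]
  have hns_l : ∀ (S T : W.geomTorsion (p : ℤ)) (n : ℕ), e (n • S) T = e S T ^ n := by
    intro S T n
    induction n with
    | zero => rw [zero_smul, hzero_l, pow_zero]
    | succ n ih => rw [add_smul, one_smul, haddl, ih, pow_succ]
  -- `e(P, c) = 1` for `c ∈ C`
  have hPC1 : ∀ c, c ∈ C → e P c = 1 := by
    intro c hc
    obtain ⟨k, rfl⟩ := hgen c hc
    rw [hzs, hself, one_zpow]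
  -- `ζ := e(P, P₂)` is primitive
  set ζ : AlgebraicClosure K := e P P₂ with hζdef
  have hζ1 : ζ ≠ 1 := by
    intro h1'
    apply hP0
    refine hnd P fun S => ?_
    -- `e S P = (e P S)⁻¹` and `e P S = 1` since `S = c + k P₂`
    have htop := sup_zmultiples_eq_top_of_not_mem hcard hV hP₂
    have hS : S ∈ C ⊔ AddSubgroup.zmultiples P₂ := by rw [htop]; exact AddSubgroup.mem_top _
    obtain ⟨c, hc, z, hz, rfl⟩ := AddSubgroup.mem_sup.mp hS
    obtain ⟨k, rfl⟩ := AddSubgroup.mem_zmultiples_iff.mp hz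
    have hPS : e P (c + k • P₂) = 1 := by
      rw [haddr, hPC1 c hc, one_mul]
      -- `e P (k • P₂) = ζ ^ k = 1`
      have : ∀ m : ℤ, e P (m • P₂) = e P P₂ ^ m := by
        intro m
        induction m using Int.induction_on with
        | zero => rw [zero_smul, hzero_r, zpow_zero]
        | succ n ih => rw [add_smul, one_smul, haddr, ih, zpow_add_one₀ (hne0 P P₂)]
        | pred n ih =>
          have h := haddr P ((-(n : ℤ) - 1) • P₂) P₂
          rw [show (-(n : ℤ) - 1) • P₂ + P₂ = (-(n : ℤ)) • P₂ by rw [sub_smul, one_smul, sub_add_cancel], ih] at h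
          rw [zpow_sub_one₀ (hne0 P P₂), eq_mul_inv_iff_mul_eq₀ (hne0 P P₂)]
          exact h.symm
      rw [this, ← hζdef, h1', one_zpow]
    have h := hskew P (c + k • P₂)
    rwa [hPS, one_mul] at h
  have hprim : IsPrimitiveRoot ζ p := by
    have hord : orderOf ζ = p := orderOf_eq_prime (hpow P P₂) hζ1
    exact hord ▸ IsPrimitiveRoot.orderOf ζ
  -- the Galois action: `τ ζ = ζ^{a₁ a₂}` whenever `τ P = a₁ P`, `τ P₂ - a₂ P₂ ∈ C`
  have hact : ∀ (τ : absoluteGaloisGroup K) (a₁ a₂ : ℕ), τ • P = a₁ • P → τ • P₂ - a₂ • P₂ ∈ C →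
      τ • ζ = ζ ^ (a₁ * a₂) := by
    intro τ a₁ a₂ hτP hτP₂
    rw [hζdef, hgal τ P P₂, hτP, hns_l,
      show τ • P₂ = (τ • P₂ - a₂ • P₂) + a₂ • P₂ by rw [sub_add_cancel], haddr, hPC1 _ hτP₂, one_mul, hns_r,
      ← pow_mul, mul_comm a₂ a₁]
  -- `ζ ∈ K(χ₁,χ₂)`: the Borel kernel acts with `a₁ = a₂ = 1`
  have hmem : ζ ∈ W.borelField C := by
    rw [borelField_def, IntermediateField.mem_fixedField_iff]
    intro σ hσ
    obtain ⟨hσC, hσV⟩ := mem_borelKernel_iff.mp hσ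
    have h := hact σ 1 1 (by rw [one_smul]; exact hσC P hPC) (by rw [one_smul]; exact hσV P₂)
    rwa [mul_one, pow_one] at h
  refine ⟨⟨ζ, hmem⟩, hprim.of_map_of_injective (f := algebraMap (↥(W.borelField C)) (AlgebraicClosure K))
    (algebraMap (↥(W.borelField C)) (AlgebraicClosure K)).injective, fun τ a₁ a₂ hτP hτP₂ => ?_⟩
  apply Subtype.ext
  rw [coe_absRestrictNormalHom_apply₄, SubmonoidClass.coe_pow]
  exact hact τ a₁ a₂ hτP hτP₂

end WeierstrassCurve

end
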